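import Mathlib
import HarnessLib

/-!
# Crux stmt-ResolutionOfSingularities-15917 (`RadicialJung.CleanModels`), skeleton `Sketch` rev 13, stub `stub_cleanPatching3`:
# REFINING a valuation to a prescribed closed centre

Plan card `Cruxes/CleanModels/Lines/Sketch-P2-plan.md` (lead `res-B-lead-1` g0, 2026-08-28).  In rev 13 of the skeleton, clean
local uniformization (`CleanLU3`) is asked only at valuations whose centre on the regular affine model has a 3-dimensional
local ring (Cossart–Piltant's own (LU) hypothesis, Prop 4.6); the patching stub must therefore handle a valuation ring `O`
whose centre `𝔭 = 𝔪_O ∩ A` on the model `A` is NOT closed by REFINING `O`: choose a maximal ideal `𝔪 ⊇ 𝔭` of `A` and a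
valuation ring `O' ⊆ O` of the same field whose centre on `A` is exactly `𝔪` — then clean-regular data at the centre of `O'`
GENERISE to the centre of `O` (`RadicialJungCleanModelsGenerisation.lean`, landed).  This file proves the valuation-theoretic
half, in general:

* `exists_valuationSubring_le_centre_eq` — for a valuation subring `O` of a field `K`, a subring `A ⊆ O` and a maximal ideal
  `𝔪` of `A` containing the centre of `O` on `A`, there is a valuation subring `O' ≤ O` containing `A` whose centre on `A` is
  `𝔪` (`a ∈ 𝔪 ↔ O'.valuation a < 1`).

Construction (Zariski–Samuel VI §16, composite valuations; Chevalley's extension theorem = Mathlib's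
`LocalSubring.exists_le_valuationSubring`): the elements of `A ∖ 𝔪` are units of `O`, so `A_𝔪 → κ(O)` (residue field of `O`)
is defined; its image is a local subring `L` of `κ(O)`; a valuation ring `W` of `κ(O)` dominating `L` exists; `O'` is the
COMPOSITE `{x ∈ O | x̄ ∈ W}`.  Pure Mathlib algebra; nothing here proves resolution in characteristic `p`.
-/

noncomputable section

set_option linter.dupNamespace false

open IsLocalRing

namespace Summit.ResolutionOfSingularities.ResolutionOfSingularities.Theorems.RadicialJung.CleanModels

/-- **Composite valuation rings.**  For a valuation subring `O` of `K` and a valuation subring `W` of the residue field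
`κ(O)`, the set `{x ∈ O | x̄ ∈ W}` is a valuation subring of `K` contained in `O` (Zariski–Samuel VI §16).
[cite: Matsumura1987, §10 (composite of valuation rings), Thm. 10.1] -/
theorem exists_composite (K : Type*) [Field K] (O : ValuationSubring K)
    (W : ValuationSubring (ResidueField O)) :
    ∃ O' : ValuationSubring K, O' ≤ O ∧
      ∀ x : O, ((x : K) ∈ O' ↔ residue O x ∈ W) := by
  classical
  let O' : ValuationSubring K :=
    { carrier := {x | ∃ h : x ∈ O, residue O ⟨x, h⟩ ∈ W}
      mul_mem' := by
        rintro x y ⟨hx, hxW⟩ ⟨hy, hyW⟩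
        refine ⟨O.toSubring.mul_mem hx hy, ?_⟩
        have : (⟨x * y, O.toSubring.mul_mem hx hy⟩ : O) = ⟨x, hx⟩ * ⟨y, hy⟩ := rfl
        rw [this, map_mul]
        exact W.toSubring.mul_mem hxW hyW
      one_mem' := ⟨O.toSubring.one_mem, by
        have : (⟨1, O.toSubring.one_mem⟩ : O) = 1 := rfl
        rw [this, map_one]; exact W.toSubring.one_mem⟩
      add_mem' := by
        rintro x y ⟨hx, hxW⟩ ⟨hy, hyW⟩
        refine ⟨O.toSubring.add_mem hx hy, ?_⟩
        have : (⟨x + y, O.toSubring.add_mem hx hy⟩ : O) = ⟨x, hx⟩ + ⟨y, hy⟩ := rfl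
        rw [this, map_add]
        exact W.toSubring.add_mem hxW hyW
      zero_mem' := ⟨O.toSubring.zero_mem, by
        have : (⟨0, O.toSubring.zero_mem⟩ : O) = 0 := rfl
        rw [this, map_zero]; exact W.toSubring.zero_mem⟩
      neg_mem' := by
        rintro x ⟨hx, hxW⟩
        refine ⟨O.toSubring.neg_mem hx, ?_⟩
        have : (⟨-x, O.toSubring.neg_mem hx⟩ : O) = -⟨x, hx⟩ := rfl
        rw [this, map_neg]
        exact W.toSubring.neg_mem hxW
      mem_or_inv_mem' := by
        -- units of `O` have their inverses in `O`
        have inv_mem_of_isUnit : ∀ {x : K} (hx : x ∈ O), IsUnit (⟨x, hx⟩ : O) → x⁻¹ ∈ O := by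
          intro x hx hu
          have hv1 : O.valuation x = 1 := (O.valuation_eq_one_iff ⟨x, hx⟩).mp hu
          apply (O.valuation_le_one_iff _).mp
          rw [map_inv₀, hv1, inv_one]
        intro x
        by_cases hxO : x ∈ O
        · by_cases hxW : residue O ⟨x, hxO⟩ ∈ W
          · exact Or.inl ⟨hxO, hxW⟩
          · -- `x̄ ∉ W`, so `x̄ ≠ 0`: `x` is a unit of `O` and `x̄⁻¹ ∈ W`
            right
            have hx0 : residue O ⟨x, hxO⟩ ≠ 0 := by
              intro h; exact hxW (h ▸ W.toSubring.zero_mem)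
            have hxu : IsUnit (⟨x, hxO⟩ : O) := by
              by_contra h
              exact hx0 ((residue_eq_zero_iff _).mpr ((mem_maximalIdeal _).mpr h))
            have hinvO : x⁻¹ ∈ O := inv_mem_of_isUnit hxO hxu
            refine ⟨hinvO, ?_⟩
            have hxne : x ≠ 0 := by
              rintro rfl
              apply hx0
              have : (⟨(0 : K), hxO⟩ : O) = 0 := Subtype.ext rfl
              rw [this, map_zero]
            have hprod : (⟨x, hxO⟩ : O) * ⟨x⁻¹, hinvO⟩ = 1 := by
              apply Subtype.ext
              change x * x⁻¹ = 1
              exact mul_inv_cancel₀ hxne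
            have hres : residue O ⟨x⁻¹, hinvO⟩ = (residue O ⟨x, hxO⟩)⁻¹ := by
              symm
              apply inv_eq_of_mul_eq_one_right
              rw [← map_mul, hprod, map_one]
            rw [hres]
            rcases W.mem_or_inv_mem (residue O ⟨x, hxO⟩) with h | h
            · exact absurd h hxW
            · exact h
        · -- `x ∉ O`: then `x⁻¹ ∈ 𝔪_O` (else `x = (x⁻¹)⁻¹ ∈ O`), so `x̄⁻¹ = 0 ∈ W`
          right
          have hinv : x⁻¹ ∈ O := (O.mem_or_inv_mem x).resolve_left hxO
          refine ⟨hinv, ?_⟩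
          have hmem : (⟨x⁻¹, hinv⟩ : O) ∈ maximalIdeal O := by
            rw [mem_maximalIdeal, mem_nonunits_iff]
            intro hu
            apply hxO
            have := inv_mem_of_isUnit hinv hu
            rwa [inv_inv] at this
          rw [(residue_eq_zero_iff _).mpr hmem]
          exact W.toSubring.zero_mem }
  refine ⟨O', fun x hx => hx.1, fun x => ⟨fun ⟨h, hW⟩ => ?_, fun h => ⟨x.2, ?_⟩⟩⟩
  · have : (⟨(x : K), h⟩ : O) = x := Subtype.ext rfl
    rwa [this] at hW
  · have : (⟨(x : K), x.2⟩ : O) = x := Subtype.ext rfl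
    rwa [this]

/-- **Refining a valuation to a prescribed closed centre.**  Let `O` be a valuation subring of a field `K`, `A ⊆ O` a subring
and `𝔪` a maximal ideal of `A` containing the centre `𝔪_O ∩ A` of `O` on `A`.  Then there is a valuation subring `O' ≤ O` of
`K` containing `A` whose centre on `A` is `𝔪`: for `a ∈ A`, `a ∈ 𝔪 ↔ O'.valuation a < 1`.  (Composite of `O` with a valuation
ring of `κ(O)` dominating the image of `A_𝔪`; Chevalley's extension theorem.) [cite: Matsumura1987, Thm. 10.2 and §10] -/
theorem exists_valuationSubring_le_centre_eq {K : Type*} [Field K] (O : ValuationSubring K) (A : Subring K)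
    (hA : A ≤ O.toSubring) (𝔪 : Ideal A) [h𝔪 : 𝔪.IsMaximal]
    (hcentre : ∀ a : A, O.valuation (a : K) < 1 → a ∈ 𝔪) :
    ∃ O' : ValuationSubring K, O' ≤ O ∧ A ≤ O'.toSubring ∧
      ∀ a : A, a ∈ 𝔪 ↔ O'.valuation (a : K) < 1 := by
  classical
  -- `A → O → κ(O)`; elements outside `𝔪` become units
  let ι : A →+* O := Subring.inclusion hA
  let φ : A →+* ResidueField O := (residue O).comp ι
  have hφunit : ∀ s : 𝔪.primeCompl, IsUnit (φ s) := by
    intro s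
    have hs : (s : A) ∉ 𝔪 := s.2
    have hsO : IsUnit (ι s) := by
      by_contra h
      exact hs (hcentre _ ((ValuationSubring.valuation_lt_one_iff O (ι s)).mp ((mem_maximalIdeal _).mpr h)))
    exact (hsO.map (residue O))
  -- `ψ : A_𝔪 → κ(O)` and its image, a local subring `L` of `κ(O)`
  let ψ : Localization.AtPrime 𝔪 →+* ResidueField O := IsLocalization.lift (M := 𝔪.primeCompl) hφunit
  have hψ : ∀ a : A, ψ (algebraMap A _ a) = φ a := fun a => IsLocalization.lift_eq hφunit a
  let L : LocalSubring (ResidueField O) := LocalSubring.range ψ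
  have hLmem : ∀ y, y ∈ L.toSubring ↔ y ∈ ψ.range := by
    intro y
    change y ∈ (LocalSubring.range ψ).toSubring ↔ _
    rw [LocalSubring.range_toSubring]
    rfl
  have hφa : ∀ a : A, φ a = residue O (ι a) := fun _ => rfl
  have hιa : ∀ a : A, ((ι a : O) : K) = (a : K) := fun _ => rfl
  -- a valuation ring `W` of `κ(O)` dominating `L`
  obtain ⟨W, hLW⟩ := L.exists_le_valuationSubring
  obtain ⟨hLW₁, hLW₂⟩ := (LocalSubring.le_def.mp hLW)
  -- the composite
  obtain ⟨O', hO'O, hO'⟩ := exists_composite K O W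
  refine ⟨O', hO'O, fun a ha => ?_, fun a => ?_⟩
  · -- `A ⊆ O'`: `ā = ψ(a/1) ∈ L ⊆ W`
    have : residue O (ι ⟨a, ha⟩) ∈ W := by
      apply hLW₁
      rw [hLmem]
      exact ⟨algebraMap A _ ⟨a, ha⟩, hψ ⟨a, ha⟩⟩
    exact (hO' (ι ⟨a, ha⟩)).mpr this
  · have haO' : (a : K) ∈ O' := (hO' (ι a)).mpr (by
      apply hLW₁; rw [hLmem]; exact ⟨algebraMap A _ a, hψ a⟩)
    rw [← ValuationSubring.valuation_lt_one_iff O' ⟨a, haO'⟩, mem_maximalIdeal, mem_nonunits_iff]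
    constructor
    · -- `a ∈ 𝔪 ⇒ a` is not a unit of `O'`
      intro ha hu
      -- then `a` is a unit of `O`, `ā` is a unit of `W` lying in `L`, hence a unit of `L`; but `ā ∈ ψ(𝔪 A_𝔪)`
      have hv1' : O'.valuation (a : K) = 1 := (O'.valuation_eq_one_iff ⟨a, haO'⟩).mp hu
      have ha0 : (a : K) ≠ 0 := by
        intro h0; rw [h0, map_zero] at hv1'; exact zero_ne_one hv1'
      have hainvO' : (a : K)⁻¹ ∈ O' := (O'.valuation_le_one_iff _).mp (by rw [map_inv₀, hv1', inv_one])
      have hainvO : (a : K)⁻¹ ∈ O := hO'O hainvO'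
      have haO : IsUnit (ι a) := by
        refine IsUnit.of_mul_eq_one ⟨(a : K)⁻¹, hainvO⟩ (Subtype.ext ?_)
        change (a : K) * (a : K)⁻¹ = 1
        exact mul_inv_cancel₀ ha0
      -- `ā` has its inverse `residue (a⁻¹)` in `W`
      have hmemW : residue O ⟨(a : K)⁻¹, hainvO⟩ ∈ W := (hO' ⟨(a : K)⁻¹, hainvO⟩).mp hainvO'
      have hprodO : ι a * ⟨(a : K)⁻¹, hainvO⟩ = 1 := by
        apply Subtype.ext
        change (a : K) * (a : K)⁻¹ = 1
        exact mul_inv_cancel₀ ha0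
      -- unit in `L` by domination
      have hmemL : residue O (ι a) ∈ L.toSubring := by rw [hLmem]; exact ⟨algebraMap A _ a, hψ a⟩
      have hunitL : IsUnit (⟨residue O (ι a), hmemL⟩ : L.toSubring) := by
        apply hLW₂.map_nonunit ⟨residue O (ι a), hmemL⟩
        refine IsUnit.of_mul_eq_one ⟨residue O ⟨(a : K)⁻¹, hainvO⟩, hmemW⟩ (Subtype.ext ?_)
        change residue O (ι a) * residue O ⟨(a : K)⁻¹, hainvO⟩ = 1
        rw [← map_mul, hprodO, map_one]
      -- but it lies in the image of the maximal ideal of `A_𝔪`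
      obtain ⟨w, hw⟩ := hunitL
      obtain ⟨winv, hwinv⟩ : ∃ z : Localization.AtPrime 𝔪, ψ z = ((↑w⁻¹ : L.toSubring) : ResidueField O) := by
        have := (↑w⁻¹ : L.toSubring).2
        rw [hLmem] at this
        obtain ⟨z, hz⟩ := this
        exact ⟨z, hz⟩
      have hprod : ψ (algebraMap A _ a * winv) = 1 := by
        rw [map_mul, hψ, hwinv, hφa]
        have hmul : ((w : L.toSubring) : ResidueField O) * ((↑w⁻¹ : L.toSubring) : ResidueField O) = 1 := by
          rw [← Subring.coe_mul, Units.mul_inv, Subring.coe_one]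
        have hw' : ((w : L.toSubring) : ResidueField O) = residue O (ι a) := by rw [hw]
        rw [← hw']
        exact hmul
      -- `algebraMap a * winv - 1 ∈ ker ψ ⊆ 𝔪 A_𝔪`, so `algebraMap a` is a unit of `A_𝔪`, i.e. `a ∉ 𝔪`
      have hker : algebraMap A (Localization.AtPrime 𝔪) a * winv - 1 ∈ maximalIdeal (Localization.AtPrime 𝔪) := by
        have hk : algebraMap A (Localization.AtPrime 𝔪) a * winv - 1 ∈ RingHom.ker ψ := by
          rw [RingHom.mem_ker, map_sub, hprod, map_one, sub_self]
        exact le_maximalIdeal (RingHom.ker_ne_top ψ) hk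
      have hunit : IsUnit (algebraMap A (Localization.AtPrime 𝔪) a) := by
        by_contra hna
        have hmem : algebraMap A (Localization.AtPrime 𝔪) a * winv ∈ maximalIdeal (Localization.AtPrime 𝔪) :=
          Ideal.mul_mem_right _ _ ((mem_maximalIdeal _).mpr hna)
        have : (1 : Localization.AtPrime 𝔪) ∈ maximalIdeal (Localization.AtPrime 𝔪) := by
          have h2 := Ideal.sub_mem _ hmem hker
          rwa [sub_sub_cancel] at h2
        exact (maximalIdeal.isMaximal _).ne_top (Ideal.eq_top_of_isUnit_mem _ this isUnit_one)
      rw [IsLocalization.AtPrime.isUnit_to_map_iff (Localization.AtPrime 𝔪) 𝔪 a] at hunit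
      exact hunit ha
    · -- `a ∉ units of O' ⇒ a ∈ 𝔪`: if `a ∉ 𝔪` then `a` is a unit of `O` with `ā⁻¹ ∈ L ⊆ W`, so `a⁻¹ ∈ O'`
      intro hnu
      by_contra ha
      apply hnu
      have hs : IsUnit (φ a) := hφunit ⟨a, ha⟩
      have haO : IsUnit (ι a) := by
        by_contra h
        exact ha (hcentre a ((ValuationSubring.valuation_lt_one_iff O (ι a)).mp ((mem_maximalIdeal _).mpr h)))
      have hva1 : O.valuation (a : K) = 1 := (O.valuation_eq_one_iff (ι a)).mp haO
      have ha0 : (a : K) ≠ 0 := by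
        intro h0; rw [h0, map_zero] at hva1; exact zero_ne_one hva1
      have hainvO : (a : K)⁻¹ ∈ O := (O.valuation_le_one_iff _).mp (by rw [map_inv₀, hva1, inv_one])
      -- `ā⁻¹ = ψ((a/1)⁻¹) ∈ L ⊆ W`
      obtain ⟨z, hz⟩ := (IsLocalization.AtPrime.isUnit_to_map_iff (Localization.AtPrime 𝔪) 𝔪 a).mpr ha
      have hprodO : ι a * ⟨(a : K)⁻¹, hainvO⟩ = 1 := by
        apply Subtype.ext
        change (a : K) * (a : K)⁻¹ = 1
        exact mul_inv_cancel₀ ha0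
      have hres_inv : residue O ⟨(a : K)⁻¹, hainvO⟩ = ψ (↑z⁻¹ : Localization.AtPrime 𝔪) := by
        have e1 : residue O (ι a) * residue O ⟨(a : K)⁻¹, hainvO⟩ = 1 := by
          rw [← map_mul, hprodO, map_one]
        have e2 : residue O (ι a) * ψ (↑z⁻¹ : Localization.AtPrime 𝔪) = 1 := by
          rw [← hφa, ← hψ a, ← map_mul, ← hz, Units.mul_inv, map_one]
        have hne : residue O (ι a) ≠ 0 := by
          intro h0; rw [h0, zero_mul] at e1; exact zero_ne_one e1
        exact mul_left_cancel₀ hne (e1.trans e2.symm)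
      have hmemW : residue O ⟨(a : K)⁻¹, hainvO⟩ ∈ W := by
        apply hLW₁; rw [hLmem]; exact ⟨_, hres_inv.symm⟩
      have hinvO' : (a : K)⁻¹ ∈ O' := (hO' ⟨(a : K)⁻¹, hainvO⟩).mpr hmemW
      refine IsUnit.of_mul_eq_one ⟨(a : K)⁻¹, hinvO'⟩ (Subtype.ext ?_)
      change (a : K) * (a : K)⁻¹ = 1
      exact mul_inv_cancel₀ ha0

end Summit.ResolutionOfSingularities.ResolutionOfSingularities.Theorems.RadicialJung.CleanModels

end
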